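import Literature.AlgebraicGeometry.Motives.DeRhamComparisonProofs
import Literature.AlgebraicGeometry.Motives.HodgeDecompositionIsInternalDischarge
import Literature.AlgebraicGeometry.Motives.HodgeDecompositionDolbeaultComparisonDischarge
import Literature.NumberTheory.Transcendental.DeRhamTheoremProofs
import Literature.NumberTheory.Transcendental.KaehlerHodgeSumHodgeNumberFact
import Literature.NumberTheory.Transcendental.KaehlerHodgeSymmDischarge
import HarnessLib

/-!
# `∑_{p+q=k} h^{p,q} = b_k` holds for compact Kähler manifolds (discharge of hodge.S18, numerical form)

Trunk **T-KAEHLER** (`AlgebraicGeometry/Motives`). Theorems-only leaf companion of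
`DeRhamComparison.lean` (the named fact
`Literature.AlgebraicGeometry.Motives.sum_hodgeNumber_eq_bettiNumber E M`, **hodge.S18** in numerical
form: for a compact Kähler manifold `M`, `∑_{p+q=k} h^{p,q}(M) = b_k(M; ℂ)` — the Frölicher spectral
sequence degenerates at `E₁`; W. V. D. Hodge (1941); C. Voisin, *Hodge Theory and Complex Algebraic
Geometry I* (2002), §6.1.3 (p. 142: `H^k(X, ℂ) = ⨁_{p+q=k} H^{p,q}`, Prop. 6.11, Lemma 6.18) with
Rem. 8.29 (pp. 204–205: `b_k = ∑_{p+q=k} h^{p,q}`); D. Huybrechts, *Complex Geometry* (2005),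
Cor. 3.2.12) and of its reduction file `DeRhamComparisonProofs.lean`, whose
`sum_hodgeNumber_eq_bettiNumber_of_hodgeDecomposition_of_exists_complexDeRhamIsoFamily` (v3) reduces
the fact to exactly three named facts, all of which are now THEOREMS of the tree:

* `isInternal_hodgePQ` (hodge.S07, `H^k_dR(M; ℂ) = ⨁_{p+q=k} H^{p,q}`):
  `isInternal_hodgePQ_holds` (`HodgeDecompositionIsInternalDischarge.lean`);
* `exists_hodgePQ_equiv_dolbeaultCohomology` (hodge.S07, `H^{p,q} ≅ H^{p,q}_∂̄(M)`, Lemma 6.18):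
  `exists_hodgePQ_equiv_dolbeaultCohomology_holds` (`HodgeDecompositionDolbeaultComparisonDischarge.lean`);
* `exists_complexDeRhamIsoFamily E` (de Rham's theorem with complex coefficients, a natural family
  `H^k_dR(M; ℂ) ≃ₗ[ℂ] H^k(M; ℂ)`): `exists_complexDeRhamIsoFamily_holds E`
  (`Transcendental/DeRhamTheoremProofs.lean`).

The module docstring of `DeRhamComparisonProofs.lean` (§*Seat protocol*) prescribes this very
one-liner "here or in a sibling importing the three discharge files"; this is that sibling.

* **`sum_hodgeNumber_eq_bettiNumber_holds E M`** — discharge of hodge.S18 (numerical form).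
* **`Literature.NumberTheory.Transcendental.sum_hodgeNumber_eq_finrank_complexDeRham_of_isManifold_complex_holds g`**
  — discharge of the corrected C12 fact `∑_{p+q=k} h^{p,q} = dim_ℂ H^k_dR(M; ℂ)` for every smooth
  metric term `g` (it fires for Kähler `g`; `KaehlerHodgeSumHodgeNumberFact.lean`), by its own
  prescribed reduction `…_of_isManifold_complex_of_hodgeDecomposition` fed the two hodge.S07 theorems;
  and `sum_hodgeNumber_eq_finrank_complexDeRham_of_isManifold` — the old C12 name
  `sum_hodgeNumber_eq_finrank_complexDeRham g` at a complex manifold (same body,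
  `…_of_isManifold_complex_iff`).
* Binder forms for consumers: `sum_hodgeNumber_eq_bettiNumber_of_isKaehlerManifold`,
  `sum_hodgeNumber_eq_finrank_complexDeRham_of_isKaehlerManifold'`.
* **`even_bettiNumber_odd`** — the classical corollary (Voisin (2002), Cor. 6.13 region; Huybrechts
  (2005), Cor. 3.2.12 (iii) "`b_k` is even for `k` odd"): on a compact Kähler manifold every odd Betti
  number `b_{2k+1}(M; ℂ)` is even, from hodge.S18 and Hodge symmetry `h^{p,q} = h^{q,p}`
  (`hodgeNumber_symm_of_isKaehlerManifold_holds`, `KaehlerHodgeSymmDischarge.lean`): the terms of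
  `∑_{p=0}^{2k+1} h^{p,2k+1-p}` pair off under `p ↦ 2k+1-p`.

No definition and no named fact is introduced (D-0026).

## References

* W. V. D. Hodge, *The Theory and Applications of Harmonic Integrals* (1941), Ch. IV.
  [HodgeHarmonicIntegrals1941]
* C. Voisin, *Hodge Theory and Complex Algebraic Geometry I* (2002), §6.1.3 (Prop. 6.11, Cor. 6.12,
  Lemma 6.18, p. 142), Rem. 8.29. [VoisinHodgeI2002] [Voisin2002]
* D. Huybrechts, *Complex Geometry* (2005), Cor. 3.2.12. [Huybrechts2005]
-/

noncomputable section

open scoped Manifold ContDiff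
open Module Finset Literature.Geometry.Kaehler Literature.NumberTheory.Transcendental

/-! ### The corrected C12 fact: `∑ h^{p,q} = dim_ℂ H^k_dR(M; ℂ)` -/

namespace Literature.NumberTheory.Transcendental

variable {E : Type*} [NormedAddCommGroup E] [NormedSpace ℂ E] [FiniteDimensional ℂ E]
  {M : Type*} [TopologicalSpace M] [ChartedSpace E M]
  [IsManifold 𝓘(ℂ, E) ω M] [IsManifold 𝓘(ℝ, E) ∞ M]
  (g : Bundle.ContMDiffRiemannianMetric 𝓘(ℝ, E) ∞ E (fun x : M ↦ TangentSpace 𝓘(ℝ, E) x))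

/-- **Hodge decomposition, numerically** (discharge of the corrected named fact
`sum_hodgeNumber_eq_finrank_complexDeRham_of_isManifold_complex g`): for every smooth metric term `g`
on the complex manifold `M` — if `M` is compact Hausdorff and `g` is Kähler, then
`∑_{p+q=k} h^{p,q} = dim_ℂ H^k_dR(M; ℂ)` for every `k`. The file's own reduction
`sum_hodgeNumber_eq_finrank_complexDeRham_of_isManifold_complex_of_hodgeDecomposition` fed the two
hodge.S07 theorems `isInternal_hodgePQ_holds` and `exists_hodgePQ_equiv_dolbeaultCohomology_holds`.
[cite: Voisin2002, §6.1.3 p. 142, Prop. 6.11 and Lemma 6.18] -/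
theorem sum_hodgeNumber_eq_finrank_complexDeRham_of_isManifold_complex_holds :
    sum_hodgeNumber_eq_finrank_complexDeRham_of_isManifold_complex g :=
  sum_hodgeNumber_eq_finrank_complexDeRham_of_isManifold_complex_of_hodgeDecomposition
    Literature.AlgebraicGeometry.Motives.isInternal_hodgePQ_holds
    Literature.AlgebraicGeometry.Motives.exists_hodgePQ_equiv_dolbeaultCohomology_holds g

/-- The old C12 name `sum_hodgeNumber_eq_finrank_complexDeRham g` holds at every COMPLEX manifold
(same body as the corrected fact, `sum_hodgeNumber_eq_finrank_complexDeRham_of_isManifold_complex_iff`;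
its closed reading without the holomorphic atlas is refuted in
`KaehlerHodgeSumHodgeNumberCounterexample.lean`, so this is the strongest true form).
[cite: Voisin2002, §6.1.3 p. 142] -/
theorem sum_hodgeNumber_eq_finrank_complexDeRham_of_isManifold :
    sum_hodgeNumber_eq_finrank_complexDeRham g :=
  (sum_hodgeNumber_eq_finrank_complexDeRham_of_isManifold_complex_iff g).1
    (sum_hodgeNumber_eq_finrank_complexDeRham_of_isManifold_complex_holds g)

omit g in
/-- **`∑_{p+q=k} h^{p,q} = dim_ℂ H^k_dR(M; ℂ)` for a compact Kähler manifold** in the sense of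
`IsKaehlerManifold` (binder form). [cite: Voisin2002, §6.1.3 p. 142] -/
theorem sum_hodgeNumber_eq_finrank_complexDeRham_of_isKaehlerManifold' [CompactSpace M] [T2Space M]
    [IsKaehlerManifold E M] (k : ℕ) :
    ∑ pq ∈ antidiagonal k, hodgeNumber E M pq.1 pq.2 = finrank ℂ (complexDeRhamCohomology E M k) := by
  obtain ⟨g, hg⟩ := IsKaehlerManifold.exists_isKaehler (E := E) (M := M)
  exact sum_hodgeNumber_eq_finrank_complexDeRham_of_isManifold_complex_holds g hg k

end Literature.NumberTheory.Transcendental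

/-! ### hodge.S18: `∑ h^{p,q} = b_k` -/

namespace Literature.AlgebraicGeometry.Motives

variable (E : Type) [NormedAddCommGroup E] [NormedSpace ℂ E] [FiniteDimensional ℂ E]
  (M : Type) [TopologicalSpace M] [ChartedSpace E M]
  [IsManifold 𝓘(ℝ, E) ∞ M] [IsManifold 𝓘(ℂ, E) ω M]

/-- **hodge.S18 (numerical Hodge-to-de Rham degeneration) holds**: for a compact Kähler manifold `M`
charted on `E`, `∑_{p+q=k} h^{p,q}(M) = b_k(M; ℂ)` for every `k` — discharge of the named fact
`sum_hodgeNumber_eq_bettiNumber E M`, by the prescribed one-liner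
`sum_hodgeNumber_eq_bettiNumber_of_hodgeDecomposition_of_exists_complexDeRhamIsoFamily` fed the three
theorems `isInternal_hodgePQ_holds`, `exists_hodgePQ_equiv_dolbeaultCohomology_holds`,
`exists_complexDeRhamIsoFamily_holds E`. [cite: VoisinHodgeI2002, §6.1.3 (p. 142) and Rem. 8.29 (pp. 204–205)] -/
theorem sum_hodgeNumber_eq_bettiNumber_holds : sum_hodgeNumber_eq_bettiNumber E M :=
  sum_hodgeNumber_eq_bettiNumber_of_hodgeDecomposition_of_exists_complexDeRhamIsoFamily E M
    isInternal_hodgePQ_holds exists_hodgePQ_equiv_dolbeaultCohomology_holds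
    (exists_complexDeRhamIsoFamily_holds E)

/-- **`∑_{p+q=k} h^{p,q} = b_k(M; ℂ)`**, binder form: for `M` compact Hausdorff with
`[IsKaehlerManifold E M]`. [cite: VoisinHodgeI2002, §6.1.3 (p. 142) and Rem. 8.29 (pp. 204–205)] -/
theorem sum_hodgeNumber_eq_bettiNumber_of_isKaehlerManifold [CompactSpace M] [T2Space M]
    [IsKaehlerManifold E M] (k : ℕ) :
    ∑ pq ∈ antidiagonal k, hodgeNumber E M pq.1 pq.2 =
      Literature.AlgebraicTopology.SingularHomology.bettiNumber ℂ M k :=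
  sum_hodgeNumber_eq_bettiNumber_holds E M k

/-- **Odd Betti numbers of a compact Kähler manifold are even** (Huybrechts (2005), Cor. 3.2.12:
"`b_k` is even for `k` odd"; Voisin (2002), §6.1.3 after Cor. 6.12): `b_{2k+1}(M; ℂ)` is even.
From hodge.S18, `b_{2k+1} = ∑_{p=0}^{2k+1} h^{p,2k+1-p}`, and Hodge symmetry `h^{p,q} = h^{q,p}`
(`hodgeNumber_symm_of_isKaehlerManifold_holds`): the reflection `p ↦ 2k+1-p` pairs the upper half of
the sum with the lower half. [cite: Huybrechts2005, Cor. 3.2.12] -/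
theorem even_bettiNumber_odd [CompactSpace M] [T2Space M] [IsKaehlerManifold E M] (k : ℕ) :
    Even (Literature.AlgebraicTopology.SingularHomology.bettiNumber ℂ M (2 * k + 1)) := by
  rw [← sum_hodgeNumber_eq_bettiNumber_holds E M (2 * k + 1),
    Nat.sum_antidiagonal_eq_sum_range_succ (fun p q ↦ hodgeNumber E M p q) (2 * k + 1)]
  have hrange : (2 * k + 1).succ = (k + 1) + (k + 1) := by omega
  rw [hrange, sum_range_add]
  -- the upper half of the sum is the lower half reflected, by Hodge symmetry
  have hs : ∀ i ∈ range (k + 1), hodgeNumber E M (k + 1 + i) (2 * k + 1 - (k + 1 + i)) =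
      hodgeNumber E M (k - i) (2 * k + 1 - (k - i)) := by
    intro i hi
    rw [mem_range] at hi
    rw [show 2 * k + 1 - (k + 1 + i) = k - i by omega, show 2 * k + 1 - (k - i) = k + 1 + i by omega]
    exact hodgeNumber_symm_of_isKaehlerManifold_holds (E := E) (M := M) (k + 1 + i) (k - i)
  have hflip : ∑ i ∈ range (k + 1), hodgeNumber E M (k - i) (2 * k + 1 - (k - i)) =
      ∑ i ∈ range (k + 1), hodgeNumber E M i (2 * k + 1 - i) :=
    sum_flip (f := fun p ↦ hodgeNumber E M p (2 * k + 1 - p))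
  rw [sum_congr rfl hs, hflip]
  exact ⟨_, rfl⟩

/-- **The first Betti number of a compact Kähler manifold is `2 h^{1,0}`** (`= 2 h^{0,1}`; Voisin
(2002), §6.1.3; Huybrechts (2005), Cor. 3.2.12): `b₁(M; ℂ) = 2 · h^{1,0}(M)`.
[cite: Huybrechts2005, Cor. 3.2.12] -/
theorem bettiNumber_one_eq_two_mul_hodgeNumber [CompactSpace M] [T2Space M] [IsKaehlerManifold E M] :
    Literature.AlgebraicTopology.SingularHomology.bettiNumber ℂ M 1 = 2 * hodgeNumber E M 1 0 := by
  rw [← sum_hodgeNumber_eq_bettiNumber_holds E M 1, Nat.sum_antidiagonal_succ, Nat.antidiagonal_zero,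
    sum_singleton]
  simp only [zero_add]
  rw [hodgeNumber_symm_of_isKaehlerManifold_holds (E := E) (M := M) 0 1, two_mul]

end Literature.AlgebraicGeometry.Motives

end
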